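import Mathlib
import Summits.ValiantsHypothesis.ValiantsHypothesis.Theorems.FifoMatchingNNDivisionHardNarrowBandLocal
import HarnessLib

/-!
# Route FifoMatching — crux `NNDivisionHard` (stmt-ValiantsHypothesis-21181): certificates are MESH-COVERING
# (the padding length `L` is a FREE parameter: every interior scale `2L`, `L ∈ [8u⁴ + 3u³, ≈ n/(24u)]`, must be hit within `2u³`)

In `…PadWordNarrowBand.lean` / `…NarrowBandLocal.lean` the padding length was tied to the thickness (`L = 8u⁴ + 3u³`, `m = u³`).
But `NNMonotoneHard.exists_thick_measure` only needs `2mr + 3m ≤ L` (`r = 4u`): the padding length `L` is FREE above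
`8u⁴ + 3u³`, up to the size constraint `12Ku + 3L + 2K ≤ n` (`K = 2L + 4m + 2`), i.e. `(24u + 7)L + 48u⁴ + 8u³ + 24u + 4 ≤ n`.
For each such pair `(u, L)` the thick-queue measure is a spread measure (`β = 2N(3/4)^{4u}`) living on matchings all of whose
arcs have length in `[L − u³ + 1, 2L + 2u³ − 1]` and all of whose INTERIOR arcs (opener `≥ L`, closer `< 2n − L`) have length in
the narrow band `[2L − 2u³ + 1, 2L + 2u³ − 1]`.  Hence:

* `exists_thick_measure_of_le_free` — the narrow-banded measure for every admissible pair `(u, L)`;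
* ★★ `freeBandAvoiding_lower_bound` / `freeBandAvoiding_not_certificate_qp` — for every `c`, eventually in `n`: for every
  admissible pair (`20 n (log₂ n + 1) ≤ u⁶`, `8u⁴ + 3u³ ≤ L`, `(24u+7)L + 48u⁴ + 8u³ + 24u + 4 ≤ n`) every `h ≠ 0` with no
  variable possible at `(u, L)` — `x_(i,j)` is possible if `j − i ∈ [L − u³ + 1, 2L + 2u³ − 1]` and, when interior (`L ≤ i`,
  `j + L < 2n`), `j − i ≥ 2L − 2u³ + 1` — satisfies `2^((log₂ n + c)^c) < L₊(NN_n · h) + L₊(h)`.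
  READING (MESH-COVERING): with `u = u_min ≈ (20 n log₂ n)^{1/6}` and `L` free in `[8u⁴ + 3u³, ≈ n/(24u)]`, an interior
  certificate cofactor must contain, for EVERY even target `2L` in `[16u⁴ + 6u³, ≈ n/(12u)]`, an arc of length within `2u³` of it:
  its arc lengths form a `2u³`-NET of `[Θ((n log n)^{2/3}), Θ(n^{5/6−o(1)})]`, so it has `Ω(n^{1/3}/log^{2/3} n)` distinct arc
  lengths (cf. `…FewLengths.lean` for the pigeonhole at fixed `L(u)`, which gave `Θ(n^{1/5})`);
* ★ BY NAME `nnDivisionHard_iff_meshCoveringTier`.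

HONEST FRAMING: a structural constraint on certificates for ONE candidate family; stmt-21181 stays OPEN (scale-covering
cofactors such as `NN_n`, `Σ_e x_e`, `(1 + Σ_e x_e)^k` are untouched by every support-avoidance argument); nothing here bears
on `NNNotVP` or on VP ≠ VNP (NOT proved).  No definitions, no named facts.
References: Hrubeš–Yehudayoff 2021 §6 Problem 2 [HrubesYehudayoff2021]; Bürgisser 2000 Rem. 2.7 [Burgisser2000].
-/

noncomputable section

-- Sub = Summit single-conjunct layout: the duplicated namespace component is mandated by the tree.
set_option linter.dupNamespace false
set_option autoImplicit false

namespace Summit.ValiantsHypothesis.ValiantsHypothesis.Theorems.FifoMatching.NNDivisionHard.FreeBand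

open Finset MvPolynomial Literature.Computability.AlgebraicComplexity
open Summit.ValiantsHypothesis.ValiantsHypothesis.Theorems.FifoMatching.NNDivisionHard.BandLocal
  (local_spreadLaw band_estimate_of_log two_pow_le_of_spreadLaw qp_lt_of_two_pow_le)
open Summit.ValiantsHypothesis.ValiantsHypothesis.Theorems.FifoMatching.NNDivisionHard.PadWordNarrowBand
  (exists_thick_measure_narrow)
open scoped NNReal BigOperators

variable {n : ℕ}

/-- **The narrow-banded thick-queue measure for a FREE padding length.**  For `u ≥ 1`, `m = u³`, ANY `L ≥ 8mu + 3m`,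
`K = 2L + 4m + 2`, `N = 2n − 2L`, `n ≥ 12Ku + 3L + 2K` and the band estimate: a probability weighting of the nest-free perfect
matchings of `[2n]` with balanced-split mass `≤ 2N (3/4)^{4u}`, supported on matchings all of whose arcs have length in
`[L − m + 1, 2L + 2m − 1]` and all of whose interior arcs (opener `≥ L`, closer `< L + N`) have length `≥ 2L − 2m + 1`. [folklore] -/
theorem exists_thick_measure_of_le_free {u n m L K N : ℕ} (hu : 1 ≤ u) (hm : m = u ^ 3)
    (hL : 8 * m * u + 3 * m ≤ L) (hK : K = 2 * L + 4 * m + 2) (hN : N = 2 * n - 2 * L)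
    (hT : 12 * K * u + 3 * L + 2 * K ≤ n)
    (hband : 2 * (N : ℝ) * Real.exp (-((m : ℝ) ^ 2 / (2 * N))) * 2 ^ N ≤ 2 ^ N / (2 * N)) :
    ∃ μ : (Fin (2 * n) → Fin (2 * n)) → ℝ≥0,
      (∑ Mt ∈ nestFreeMatchings (2 * n), μ Mt = 1) ∧
      (∀ S : Finset (Fin (2 * n)), 2 * n < 3 * S.card → 3 * S.card ≤ 4 * n →
        (∑ Mt ∈ (nestFreeMatchings (2 * n)).filter (fun Mt => ∀ i, i ∈ S ↔ Mt i ∈ S), μ Mt)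
          ≤ (2 * N : ℝ≥0) * ((3 : ℝ≥0) / 4) ^ (4 * u)) ∧
      (∀ Mt ∈ nestFreeMatchings (2 * n), μ Mt ≠ 0 → ∀ i ∈ openers Mt,
        ((i : ℕ) + (L - m + 1) ≤ (Mt i : ℕ) ∧ (Mt i : ℕ) + 1 ≤ (i : ℕ) + (2 * L + 2 * m)) ∧
        (L ≤ (i : ℕ) → (Mt i : ℕ) < L + N → (i : ℕ) + (2 * L - 2 * m + 1) ≤ (Mt i : ℕ))) := by
  set J : ℕ := (N - 1) / K with hJ
  have hKpos : 0 < K := by rw [hK]; omega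
  have hm1 : 1 ≤ m := by rw [hm]; exact Nat.one_le_pow _ _ hu
  -- linearise the products for `omega`
  have eT : 12 * K * u = 12 * (K * u) := by ring
  have eL : 8 * m * u = 8 * (m * u) := by ring
  have er : 2 * K * (4 * u) = 8 * (K * u) := by ring
  have e16 : 4 * (4 * u) * K = 16 * (K * u) := by ring
  have emr : 2 * m * (4 * u) + 3 * m = 8 * (m * u) + 3 * m := by ring
  rw [eT] at hT
  rw [eL] at hL
  have hLn : L ≤ n := by omega
  have hM : L + N + L = 2 * n := by rw [hN]; omega
  have hmL : m ≤ L := by omega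
  have hKe : 2 * L + 4 * m + 2 ≤ K := by rw [hK]
  have hNpos : 0 < N := by rw [hN]; omega
  -- `J K ≤ N - 1 < J K + K`
  have hdiv : K * J + (N - 1) % K = N - 1 := by rw [hJ]; exact Nat.div_add_mod (N - 1) K
  have hmod : (N - 1) % K < K := Nat.mod_lt _ hKpos
  have eKJ : K * J = J * K := Nat.mul_comm _ _
  have hJK : J * K + 1 ≤ N := by omega
  have hJK' : N ≤ J * K + K := by omega
  have hr1 : 4 * (4 * u) ≤ J := by
    rw [hJ, Nat.le_div_iff_mul_le hKpos, e16]
    omega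
  have hr3 : 2 * m * (4 * u) + 3 * m ≤ L := by rw [emr]; exact hL
  have hreg : 3 * (2 * K * (4 * u) + (2 * n - J * K)) ≤ 2 * n := by
    rw [er]
    omega
  exact exists_thick_measure_narrow hM hmL hm1 hKe hJK hr1 hr3 hreg hNpos hband

/-- ★★ **FREE-BAND-AVOIDING COFACTORS, every admissible pair `(u, L)`.**  Let `20 n (log₂ n + 1) ≤ u⁶`, `8u⁴ + 3u³ ≤ L` and
`(24u + 7)L + 48u⁴ + 8u³ + 24u + 4 ≤ n`.  Then every `h ≠ 0` with NO variable `x_(i,j)` possible at `(u, L)` — i.e. none with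
`j − i ∈ [L − u³ + 1, 2L + 2u³ − 1]` and (`L ≤ i` → `j + L < 2n` → `2L − 2u³ + 1 ≤ j − i`) — satisfies
`2^u ≤ 16 n (n+1)² (L₊(NN_n · h) + 1)`. [cite: HrubesYehudayoff2021, §6 Problem 2] [cite: Burgisser2000, Rem. 2.7] -/
theorem freeBandAvoiding_lower_bound {u L : ℕ} (hu : 1 ≤ u) (hlog : 20 * n * (Nat.log 2 n + 1) ≤ u ^ 6)
    (hL : 8 * u ^ 4 + 3 * u ^ 3 ≤ L) (hT : (24 * u + 7) * L + 48 * u ^ 4 + 8 * u ^ 3 + 24 * u + 4 ≤ n)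
    {h : MvPolynomial (Fin (2 * n) × Fin (2 * n)) ℝ≥0} (hh : h ≠ 0)
    (havoid : ∀ e ∈ h.vars, ¬ ((L ≤ (e.1 : ℕ) → (e.2 : ℕ) + L < 2 * n → (e.1 : ℕ) + (2 * L - 2 * u ^ 3 + 1) ≤ (e.2 : ℕ)) ∧
      (e.1 : ℕ) + (L - u ^ 3 + 1) ≤ (e.2 : ℕ) ∧ (e.2 : ℕ) + 1 ≤ (e.1 : ℕ) + (2 * L + 2 * u ^ 3))) :
    2 ^ u ≤ 16 * n * (n + 1) ^ 2 * (complexity (nestFreeMatchingPoly n ℝ≥0 * h) + 1) := by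
  classical
  -- the parameters
  set m : ℕ := u ^ 3 with hm
  set K : ℕ := 2 * L + 4 * m + 2 with hK
  set N : ℕ := 2 * n - 2 * L with hN
  have e4 : u ^ 4 = m * u := by rw [hm]; ring
  have hL' : 8 * m * u + 3 * m ≤ L := by
    rw [show 8 * m * u = 8 * (m * u) by ring, ← e4]; exact hL
  have hT' : 12 * K * u + 3 * L + 2 * K ≤ n := by
    have : 12 * K * u + 3 * L + 2 * K = (24 * u + 7) * L + 48 * u ^ 4 + 8 * u ^ 3 + 24 * u + 4 := by
      simp only [hK, hm]; ring
    rw [this]; exact hT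
  have hNle : N ≤ 2 * n := by rw [hN]; omega
  have hLn : L < n := by nlinarith
  have hNpos : 0 < N := by rw [hN]; omega
  have hn3 : 3 ≤ n := by
    have : 3 ≤ L := by
      have h3 : 3 * u ^ 3 ≥ 3 := by nlinarith [Nat.one_le_pow 3 u hu]
      omega
    omega
  have hm2 : 20 * n * (Nat.log 2 n + 1) ≤ m ^ 2 := by
    rw [hm, ← pow_mul]; exact hlog
  have hband := band_estimate_of_log hNpos hNle hm2
  -- the narrow-banded measure with free `L` and the generic local law
  obtain ⟨μ, hμ1, hμS, hμB⟩ := exists_thick_measure_of_le_free hu hm hL' hK hN hT' hband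
  set I : Finset (Fin (2 * n) × Fin (2 * n)) := univ.filter fun e =>
    ¬ ((L ≤ (e.1 : ℕ) → (e.2 : ℕ) + L < 2 * n → (e.1 : ℕ) + (2 * L - 2 * m + 1) ≤ (e.2 : ℕ)) ∧
      (e.1 : ℕ) + (L - m + 1) ≤ (e.2 : ℕ) ∧ (e.2 : ℕ) + 1 ≤ (e.1 : ℕ) + (2 * L + 2 * m)) with hI
  have hμI : ∀ M ∈ nestFreeMatchings (2 * n), μ M ≠ 0 → ∀ i ∈ openers M, (i, M i) ∉ I := by
    intro M hM hμM i hi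
    obtain ⟨⟨hlo, hhi⟩, hmid⟩ := hμB M hM hμM i hi
    rw [hI, mem_filter, not_and, not_not]
    intro _
    refine ⟨fun h1 h2 => hmid h1 ?_, hlo, hhi⟩
    have h2' : (M i : ℕ) + L < 2 * n := h2
    omega
  have hloc : ∀ e ∈ h.vars, e ∈ I := by
    intro e he
    rw [hI, mem_filter]
    exact ⟨mem_univ _, havoid e he⟩
  have hlaw := local_spreadLaw hn3 I μ hμ1 hμI hμS hh hloc
  exact two_pow_le_of_spreadLaw hNle (by exact_mod_cast hlaw)

/-- ★★ **FREE-BAND-AVOIDING COFACTORS ARE NOT CERTIFICATES — CERTIFICATES ARE MESH-COVERING.**  For every `c`, eventually in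
`n`: for every admissible pair `(u, L)` (`20 n (log₂ n + 1) ≤ u⁶`, `8u⁴ + 3u³ ≤ L`, `(24u+7)L + 48u⁴ + 8u³ + 24u + 4 ≤ n`) and every
`h ≠ 0` with no variable possible at `(u, L)`, `2^((log₂ n + c)^c) < L₊(NN_n · h) + L₊(h)`.
[cite: HrubesYehudayoff2021, §6 Problem 2] [cite: Burgisser2000, Rem. 2.7] -/
theorem freeBandAvoiding_not_certificate_qp (c : ℕ) : ∃ n₀ : ℕ, ∀ n : ℕ, n₀ ≤ n → ∀ u L : ℕ,
    20 * n * (Nat.log 2 n + 1) ≤ u ^ 6 → 8 * u ^ 4 + 3 * u ^ 3 ≤ L →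
    (24 * u + 7) * L + 48 * u ^ 4 + 8 * u ^ 3 + 24 * u + 4 ≤ n →
    ∀ h : MvPolynomial (Fin (2 * n) × Fin (2 * n)) ℝ≥0, h ≠ 0 →
      (∀ e ∈ h.vars, ¬ ((L ≤ (e.1 : ℕ) → (e.2 : ℕ) + L < 2 * n → (e.1 : ℕ) + (2 * L - 2 * u ^ 3 + 1) ≤ (e.2 : ℕ)) ∧
        (e.1 : ℕ) + (L - u ^ 3 + 1) ≤ (e.2 : ℕ) ∧ (e.2 : ℕ) + 1 ≤ (e.1 : ℕ) + (2 * L + 2 * u ^ 3))) →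
      2 ^ ((Nat.log 2 n + c) ^ c) < complexity (nestFreeMatchingPoly n ℝ≥0 * h) + complexity h := by
  obtain ⟨n₀, hn₀⟩ := qp_lt_of_two_pow_le c
  refine ⟨n₀, fun n hn u L hlog hL hT h hh havoid => ?_⟩
  have hun : n ≤ u ^ 6 := by
    have : n ≤ 20 * n * (Nat.log 2 n + 1) := by nlinarith
    exact this.trans hlog
  have h6 : u ^ 6 ≠ 0 := by
    intro h0
    rw [h0] at hun
    have : n = 0 := by omega
    subst this
    omega
  have hu : 1 ≤ u := Nat.pos_of_ne_zero fun h0 => h6 (by rw [h0]; norm_num)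
  exact hn₀ n hn u _ _ hun (freeBandAvoiding_lower_bound hu hlog hL hT hh havoid)

/-! ### By name -/

/-- ★ **BY NAME: `NNDivisionHard` ⟺ its MESH-COVERING tier.**  The crux (stmt-ValiantsHypothesis-21181) is equivalent to the
same inequality for the cofactors `h` which, for EVERY admissible pair `(u, L)`, have a variable `x_(i,j)` possible at `(u, L)`
(`j − i ∈ [L − u³ + 1, 2L + 2u³ − 1]`, and `j − i ≥ 2L − 2u³ + 1` if `L ≤ i` and `j + L < 2n`). [cite: HrubesYehudayoff2021, §6 Problem 2] -/
theorem nnDivisionHard_iff_meshCoveringTier :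
    Summit.ValiantsHypothesis.ValiantsHypothesis.Theses.FifoMatching.NNDivisionHard ↔
    ∀ c : ℕ, ∃ n₀ : ℕ, ∀ n ≥ n₀, ∀ h : MvPolynomial (Fin (2 * n) × Fin (2 * n)) ℝ≥0, h ≠ 0 →
      (∀ u L : ℕ, 20 * n * (Nat.log 2 n + 1) ≤ u ^ 6 → 8 * u ^ 4 + 3 * u ^ 3 ≤ L →
        (24 * u + 7) * L + 48 * u ^ 4 + 8 * u ^ 3 + 24 * u + 4 ≤ n →
        ∃ e ∈ h.vars, (L ≤ (e.1 : ℕ) → (e.2 : ℕ) + L < 2 * n → (e.1 : ℕ) + (2 * L - 2 * u ^ 3 + 1) ≤ (e.2 : ℕ)) ∧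
          (e.1 : ℕ) + (L - u ^ 3 + 1) ≤ (e.2 : ℕ) ∧ (e.2 : ℕ) + 1 ≤ (e.1 : ℕ) + (2 * L + 2 * u ^ 3)) →
      2 ^ ((Nat.log 2 n + c) ^ c) < complexity (nestFreeMatchingPoly n ℝ≥0 * h) + complexity h := by
  constructor
  · intro hN c
    obtain ⟨n₀, hn₀⟩ := hN c
    exact ⟨n₀, fun n hn h hh _ => hn₀ n hn h hh⟩
  · intro H c
    obtain ⟨n₀, hn₀⟩ := H c
    obtain ⟨n₁, hn₁⟩ := freeBandAvoiding_not_certificate_qp c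
    refine ⟨max n₀ n₁, fun n hn h hh => ?_⟩
    by_contra hq
    apply hq
    apply hn₀ n (le_trans (le_max_left _ _) hn) h hh
    intro u L hlog hL hT
    by_contra hex
    apply hq
    exact hn₁ n (le_trans (le_max_right _ _) hn) u L hlog hL hT h hh fun e he hQ => hex ⟨e, he, hQ⟩

end Summit.ValiantsHypothesis.ValiantsHypothesis.Theorems.FifoMatching.NNDivisionHard.FreeBand

end
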